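import Mathlib
import Summits.MatrixMultiplication.MatrixMultiplication.Theses.StabilizerTensorRank
import Literature.Computability.AlgebraicComplexity.StabilizerTensorRank
import Literature.Computability.QuantumComplexity.CliffordSimulator
import Literature.Computability.QuantumComplexity.QubitRouting

/-!
# `StrassenStabilizer` — Strassen's seven products form a stabilizer scheme (route
StabilizerTensorRank, item `stmt-MatrixMultiplication-3832`)

`χ₃(⟨2,2,2⟩) ≤ 7`: the matrix multiplication tensor `⟨2,2,2⟩ = matMulTensor ℂ 2 2 2` has a
decomposition `∑_{i<7} cᵢ · wᵢ ⊗ uᵢ ⊗ vᵢ` all of whose `21` legs, read as two-qubit vectors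
(row bit, column bit: `legBits 1`), are stabilizer states (`stabilizerStates 2`, the Clifford
orbit of `|00⟩`).  The legs are Strassen's (1969): `M₁ = (A₁₁+A₂₂)(B₁₁+B₂₂)`,
`M₂ = (A₂₁+A₂₂)B₁₁`, `M₃ = A₁₁(B₁₂−B₂₂)`, `M₄ = A₂₂(B₂₁−B₁₁)`, `M₅ = (A₁₁+A₁₂)B₂₂`,
`M₆ = (A₂₁−A₁₁)(B₁₁+B₁₂)`, `M₇ = (A₁₂−A₂₂)(B₂₁+B₂₂)`, `C₁₁ = M₁+M₄−M₅+M₇`, `C₁₂ = M₃+M₅`,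
`C₂₁ = M₂+M₄`, `C₂₂ = M₁−M₂+M₃+M₆`; normalised, every leg is `|00⟩`, `|11⟩`, a product
`|b⟩|±⟩`, `|±⟩|b⟩`, or the Bell pair `(|00⟩+|11⟩)/√2`, each prepared from `|00⟩` by a word over
`H, S, CNOT` (`X = HSSH`, `Z = SS`, Bell `= CNOT₀₁ H₀`).

Proof architecture (no definitions, no notations: the three word tables and the integer
coefficients are `let`s inside the one proof that needs them):

* the `21` preparation words are run on the vacuum by the tree's kernel-executable Clifford
  simulator (`CliffordSim.run`, amplitudes in `ℤ[ω]`, `H` scaled by `√2`, so `X = HSSH` carries a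
  factor `2`); `CliffordSim.exists_stabilizer` says each result is `√2^{#H}` times a stabilizer
  state `φ`;
* the legs of the scheme are `φ ∘ (bitSplitEquiv 1)⁻¹`, so the stabilizer condition is immediate;
* the tensor identity is the integer identity
  `4 · ⟨2,2,2⟩(x,y,z) = ∑ᵢ dᵢ · W̃ᵢ(x) Ũᵢ(y) Ṽᵢ(z)` (`d = (4,1,1,−1,−1,−1,1)`: the signs of the
  three legs prepared with the opposite sign and the factors `2` of the `X` gates, against a
  global `4`; tildes = scaled simulator outputs) on all `4³` bit triples, DECIDED BY THE KERNEL in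
  `ℤ[ω]`-arithmetic, then mapped to `ℂ` by `Amp.eval ω` and divided by the scales, giving the
  coefficients `cᵢ = dᵢ/4 · √2^{#H(Wᵢ)+#H(Uᵢ)+#H(Vᵢ)}` (numerically `2√2, 2, 2, −2, −2, −2, 2`).

References: V. Strassen, *Gaussian elimination is not optimal*, Numer. Math. 13 (1969) 354–356;
S. Aaronson, D. Gottesman, PRA 70 (2004) 052328, Thm 1 (stabilizer states = Clifford circuits on
`|0ⁿ⟩`); the route's idea card stabilizer-bilinear-complexity (arXiv:1708.09398 for the
group-orbit reading of Strassen's algorithm).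
-/

-- the summit's layout `Summit.MatrixMultiplication.MatrixMultiplication` duplicates a namespace
-- component by design (single-conjunct summit); silence the corresponding linter as its siblings do
set_option linter.dupNamespace false

noncomputable section

namespace Summit.MatrixMultiplication.MatrixMultiplication.Theorems

namespace StrassenStab

open Literature.Computability Literature.Computability.QuantumComplexity
  Literature.Computability.QuantumComplexity.CliffordSim
  Literature.Computability.QuantumComplexity.LightCone Literature.Computability.Cryptography

/-! ### Bit splitting at `k = 1` and the matrix multiplication tensor in bit coordinates -/

/-- `bitSplitEquiv 1` on an explicit two-bit string: (row index, column index) = (bit 0, bit 1),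
decided by the kernel. -/
theorem bitSplitEquiv_one_vec : ∀ a b : Bool,
    AlgebraicComplexity.bitSplitEquiv 1 ![a, b] = (finTwoEquiv.symm a, finTwoEquiv.symm b) := by
  decide

/-- `bitSplitEquiv 1 x = (x₀, x₁)` (bits read as elements of `Fin 2`). -/
theorem bitSplitEquiv_one_apply (x : QReg (1 + 1)) :
    AlgebraicComplexity.bitSplitEquiv 1 x = (finTwoEquiv.symm (x 0), finTwoEquiv.symm (x 1)) := by
  have h := bitSplitEquiv_one_vec (x 0) (x 1)
  rwa [← qReg_two_eq x] at h

/-- The tensor `⟨2,2,2⟩` in bit coordinates: entry `1` iff row(C) = row(A), col(A) = row(B) and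
col(C) = col(B), else `0`. -/
theorem matMulTensor_bitSplit (x y z : QReg (1 + 1)) :
    AlgebraicComplexity.matMulTensor ℂ (2 ^ 1) (2 ^ 1) (2 ^ 1) (AlgebraicComplexity.bitSplitEquiv 1 x)
      (AlgebraicComplexity.bitSplitEquiv 1 y) (AlgebraicComplexity.bitSplitEquiv 1 z) =
      if x 0 = y 0 ∧ y 1 = z 0 ∧ x 1 = z 1 then (1 : ℂ) else 0 := by
  simp only [AlgebraicComplexity.matMulTensor, bitSplitEquiv_one_apply, Equiv.apply_eq_iff_eq]

/-- The value of the constant `4 ∈ ℤ[ω]` (coordinates `(4,0,0,0)`). -/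
theorem eval_four (ζ : ℂ) : Amp.eval ζ ⟨4, 0, 0, 0⟩ = 4 := by
  simp [Amp.eval]

/-! ### The stabilizer scheme -/

/-- **`χ₃(⟨2,2,2⟩) ≤ 7`**: `⟨2^1, 2^1, 2^1⟩` has a stabilizer scheme with `7` terms
(`HasStabilizerScheme 1 7` of `StabilizerTensorRank.lean`): Strassen's algorithm with normalised
legs.  Inside the proof: the `21` Clifford words (`W`, `U`, `V`; wire `0` = row bit, wire `1` =
column bit; `[H₀, CNOT₀₁]` = Bell pair `|00⟩+|11⟩`, `[Hₖ]` = `|+⟩` on wire `k`, `[Hₖ,Sₖ,Sₖ]` =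
`|−⟩` on wire `k`, `[Hₖ,Sₖ,Sₖ,Hₖ]` = `X` on wire `k` with scale `2`), the integer coefficients
`D`, the kernel-decided identity `hbits`, its complex form `hcomplex`, and the assembly. -/
theorem hasStabilizerScheme_one_seven : AlgebraicComplexity.HasStabilizerScheme 1 7 := by
  -- Strassen's OUTPUT legs `C₁₁+C₂₂, C₂₁−C₂₂, C₁₂+C₂₂, C₁₁+C₂₁, −(C₁₂−C₁₁), C₂₂, C₁₁` (scaled)
  let W : Fin 7 → List (Op 2) :=
    ![[Op.H 0, Op.CX 0 1 (by decide)],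
      [Op.H 0, Op.S 0, Op.S 0, Op.H 0, Op.H 1, Op.S 1, Op.S 1],
      [Op.H 0, Op.H 1, Op.S 1, Op.S 1, Op.H 1],
      [Op.H 0],
      [Op.H 1, Op.S 1, Op.S 1],
      [Op.H 0, Op.S 0, Op.S 0, Op.H 0, Op.H 1, Op.S 1, Op.S 1, Op.H 1],
      []]
  -- Strassen's `A`-legs `A₁₁+A₂₂, A₂₁+A₂₂, A₁₁, A₂₂, A₁₁+A₁₂, −(A₂₁−A₁₁), A₁₂−A₂₂` (scaled)
  let U : Fin 7 → List (Op 2) :=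
    ![[Op.H 0, Op.CX 0 1 (by decide)],
      [Op.H 0, Op.S 0, Op.S 0, Op.H 0, Op.H 1],
      [],
      [Op.H 0, Op.S 0, Op.S 0, Op.H 0, Op.H 1, Op.S 1, Op.S 1, Op.H 1],
      [Op.H 1],
      [Op.H 0, Op.S 0, Op.S 0],
      [Op.H 0, Op.S 0, Op.S 0, Op.H 1, Op.S 1, Op.S 1, Op.H 1]]
  -- Strassen's `B`-legs `B₁₁+B₂₂, B₁₁, B₁₂−B₂₂, −(B₂₁−B₁₁), B₂₂, B₁₁+B₁₂, B₂₁+B₂₂` (scaled)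
  let V : Fin 7 → List (Op 2) :=
    ![[Op.H 0, Op.CX 0 1 (by decide)],
      [],
      [Op.H 0, Op.S 0, Op.S 0, Op.H 1, Op.S 1, Op.S 1, Op.H 1],
      [Op.H 0, Op.S 0, Op.S 0],
      [Op.H 0, Op.S 0, Op.S 0, Op.H 0, Op.H 1, Op.S 1, Op.S 1, Op.H 1],
      [Op.H 1],
      [Op.H 0, Op.S 0, Op.S 0, Op.H 0, Op.H 1]]
  -- the integer coefficients `d = (4, 1, 1, −1, −1, −1, 1)`
  let D : Fin 7 → Amp := ![⟨4, 0, 0, 0⟩, 1, 1, -1, -1, -1, 1]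
  -- the `i`-th scaled term `dᵢ · W̃ᵢ(x) Ũᵢ(y) Ṽᵢ(z)` in `ℤ[ω]`
  let T : Fin 7 → QReg 2 → QReg 2 → QReg 2 → Amp := fun i x y z =>
    Amp.mul (D i) (Amp.mul (Vec.eval (run (W i) (Vec.vac 2)) x)
      (Amp.mul (Vec.eval (run (U i) (Vec.vac 2)) y) (Vec.eval (run (V i) (Vec.vac 2)) z)))
  -- the words are `T`-free
  have hW : ∀ i : Fin 7, ∀ o ∈ W i, o.isClifford = true := by
    intro i; fin_cases i <;> decide
  have hU : ∀ i : Fin 7, ∀ o ∈ U i, o.isClifford = true := by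
    intro i; fin_cases i <;> decide
  have hV : ∀ i : Fin 7, ∀ o ∈ V i, o.isClifford = true := by
    intro i; fin_cases i <;> decide
  -- **Strassen's identity in the scaled stabilizer arithmetic**, decided by the kernel on all
  -- `64` bit triples: `4·[x₀=y₀ ∧ y₁=z₀ ∧ x₁=z₁] = ∑ᵢ dᵢ W̃ᵢ(x) Ũᵢ(y) Ṽᵢ(z)` in `ℤ[ω]`.
  have hbits : ∀ x₀ x₁ y₀ y₁ z₀ z₁ : Bool,
      (if x₀ = y₀ ∧ y₁ = z₀ ∧ x₁ = z₁ then (⟨4, 0, 0, 0⟩ : Amp) else 0) =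
        T 0 ![x₀, x₁] ![y₀, y₁] ![z₀, z₁] + T 1 ![x₀, x₁] ![y₀, y₁] ![z₀, z₁] +
        T 2 ![x₀, x₁] ![y₀, y₁] ![z₀, z₁] + T 3 ![x₀, x₁] ![y₀, y₁] ![z₀, z₁] +
        T 4 ![x₀, x₁] ![y₀, y₁] ![z₀, z₁] + T 5 ![x₀, x₁] ![y₀, y₁] ![z₀, z₁] +
        T 6 ![x₀, x₁] ![y₀, y₁] ![z₀, z₁] := by
    decide +kernel
  -- the same for arbitrary bit strings
  have hamp : ∀ x y z : QReg 2,
      (if x 0 = y 0 ∧ y 1 = z 0 ∧ x 1 = z 1 then (⟨4, 0, 0, 0⟩ : Amp) else 0) =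
        T 0 x y z + T 1 x y z + T 2 x y z + T 3 x y z + T 4 x y z + T 5 x y z + T 6 x y z := by
    intro x y z
    have h := hbits (x 0) (x 1) (y 0) (y 1) (z 0) (z 1)
    rw [← qReg_two_eq x, ← qReg_two_eq y, ← qReg_two_eq z] at h
    exact h
  -- **the identity over `ℂ`**: `Amp.eval ω` is additive and multiplicative (`ω⁴ = −1`)
  have hcomplex : ∀ x y z : QReg 2,
      (if x 0 = y 0 ∧ y 1 = z 0 ∧ x 1 = z 1 then (4 : ℂ) else 0) =
        ∑ i : Fin 7, Amp.eval omega (D i) * (Vec.toState (run (W i) (Vec.vac 2)) x *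
          (Vec.toState (run (U i) (Vec.vac 2)) y * Vec.toState (run (V i) (Vec.vac 2)) z)) := by
    intro x y z
    have h := congrArg (Amp.eval omega) (hamp x y z)
    simp only [T, apply_ite (Amp.eval omega), Amp.eval_add, Amp.eval_mul omega_pow_four,
      Amp.eval_zero, eval_four] at h
    rw [Fin.sum_univ_seven]
    simpa only [Vec.toState_apply] using h
  -- the `21` stabilizer states: `√2^{#H} • φ = (scaled simulator output)`
  choose φW hφW hSW using fun i : Fin 7 => exists_stabilizer (W i) (hW i)
  choose φU hφU hSU using fun i : Fin 7 => exists_stabilizer (U i) (hU i)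
  choose φV hφV hSV using fun i : Fin 7 => exists_stabilizer (V i) (hV i)
  set s : ℂ := ((Real.sqrt 2 : ℝ) : ℂ) with hs
  set e := AlgebraicComplexity.bitSplitEquiv 1 with he
  refine ⟨fun i => Amp.eval omega (D i) / 4 * (s ^ countH (W i) * s ^ countH (U i) * s ^ countH (V i)),
    fun i => φW i ∘ e.symm, fun i => φU i ∘ e.symm, fun i => φV i ∘ e.symm,
    fun i => ⟨?_, ?_, ?_⟩, ?_⟩
  · -- legs read back along `bitSplitEquiv 1` are the stabilizer states themselves
    rw [AlgebraicComplexity.legBits_eq_comp]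
    convert hφW i using 1
    funext x
    simp [he]
  · rw [AlgebraicComplexity.legBits_eq_comp]
    convert hφU i using 1
    funext x
    simp [he]
  · rw [AlgebraicComplexity.legBits_eq_comp]
    convert hφV i using 1
    funext x
    simp [he]
  · -- the tensor identity, entry by entry in bit coordinates
    funext a b c
    obtain ⟨x, rfl⟩ := e.surjective a
    obtain ⟨y, rfl⟩ := e.surjective b
    obtain ⟨z, rfl⟩ := e.surjective c
    rw [Finset.sum_apply, Finset.sum_apply, Finset.sum_apply]
    simp only [Pi.smul_apply, AlgebraicComplexity.triad_apply, Function.comp_apply,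
      Equiv.symm_apply_apply, smul_eq_mul]
    rw [he, matMulTensor_bitSplit x y z]
    have key := hcomplex x y z
    simp only [hSW, hSU, hSV, Pi.smul_apply, smul_eq_mul] at key
    have hsum : (∑ i : Fin 7, Amp.eval omega (D i) / 4 *
        (s ^ countH (W i) * s ^ countH (U i) * s ^ countH (V i)) * (φW i x * φU i y * φV i z)) =
        (1 / 4 : ℂ) * ∑ i : Fin 7, Amp.eval omega (D i) * (s ^ countH (W i) * φW i x *
          (s ^ countH (U i) * φU i y * (s ^ countH (V i) * φV i z))) := by
      rw [Finset.mul_sum]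
      exact Finset.sum_congr rfl fun i _ => by ring
    rw [hsum, ← key]
    split_ifs <;> norm_num

end StrassenStab

/-- Settles `stmt-MatrixMultiplication-3832` (`StrassenStabilizer`, route StabilizerTensorRank),
exact signature: Strassen's seven products, with normalised legs, form a stabilizer scheme of
`⟨2,2,2⟩` — the route decl is `HasStabilizerScheme 1 7` unfolded (`hasStabilizerScheme_iff`). -/
theorem strassenStabilizer_proof : Theses.StabilizerTensorRank.StrassenStabilizer :=
  (Literature.Computability.AlgebraicComplexity.hasStabilizerScheme_iff 1 7).1
    StrassenStab.hasStabilizerScheme_one_seven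

end Summit.MatrixMultiplication.MatrixMultiplication.Theorems

end
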